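/-
Origin: expansion seat `planner-pub-hodgecm-seam-s409-chk-g3-0`, handover #6 05:01Z md5 d37fc4ef9b3c (244 l.; supersedes this seat's 2db576bcf312 AND pv07-g9's staged pkg-stage/HodgeCM/PerL34/SiegelWeilPlaceHyp.lean fd58a2c99d10 (STATUS 04:45:30Z, no kit row) — MERGED LEAF for the ONE target: part A = pv07-g9's header + docstring + three theorems VERBATIM (x1_of_weil_hermitianU0 = Option A′ `hdef : W.placeHyp = HermitianU0Nonempty …`, x1_of_weil_of_hermitianU0, x1_of_we (`HOME/pub-hodgecm-seam-s409-chk-g3/pkg/HodgeCM/PerL34/SiegelWeilPlaceHyp.lean`, md5 d37fc4ef, 244 lines);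
landed by the gen-10 packager (p-g10) in gate run 34 as `HodgeCM/PerL34/SiegelWeilPlaceHyp.lean` (verbatim).
-/
/-
Origin (MERGED leaf, one target): (A) HOME/pub-hodgecm-pv07-g9/pkg-stage/HodgeCM/PerL34/SiegelWeilPlaceHyp.lean — session
planner-pub-hodgecm-pv07-g9-0 (unit pub-hodgecm-pv07-g9, DAG-NODE PROVER #07 gen 9 → SEAMS sprint S4-09 kernel worker), staged
2026-08-19T04:45:30Z, md5 fd58a2c99d10: its header, module docstring and THREE THEOREMS are kept VERBATIM below (part A);
(B) HOME/pub-hodgecm-seam-s409-chk-g3/pkg/HodgeCM/PerL34/SiegelWeilPlaceHyp.lean — session planner-pub-hodgecm-seam-s409-chk-g3-0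
(unit pub-hodgecm-seam-s409-chk-g3, SEAMS sprint strike team S4-09 CHECKLIST gen 3), 2026-08-19: part B appended (the datum-level
instantiation `SiegelWeilDatum.withHermitianPlace` + `x1_of_weil_hermitianPlace` / `_global` / `_three_one` + Théorème-5 junctions),
merged by (B) so that RUN 34 receives ONE file for the one target; (B) also ships the five vendored twins this leaf imports and
rehearsed the merged file in the package environment (kit `HOME/pub-hodgecm-seam-s409-chk-g3/t34-s409chkg3.txt`).
Intended final place: `HodgeCM/PerL34/SiegelWeilPlaceHyp.lean` (NEW leaf; imports the run-26 leaf `HodgeCM.PerL34.SiegelWeilFromWeil`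
(unchanged, md5 bc7eab5c7d62) and the VENDORED twin of the harness-tree file
`lean/Literature/NumberTheory/Weil1965/HermitianPlaceHypothesis.lean` (hub ledger p183516 ACCEPTED 2026-08-19T04:36:12Z, commit
b209e6c57301, md5 4c95b12f421d; vendoring closure: `Literature/NumberTheory/QuadraticForms/{Meyer,HasseMinkowski,DiagonalFormIsotropy}.lean`,
`Literature/NumberTheory/Weil1965/SiegelWeilFormula.lean` + the already-vendored Hilbert-symbol quinary chain); nothing imports it).
--- part (A)'s original header follows verbatim ---
Origin: HOME/pub-hodgecm-pv07-g9/pkg-stage/HodgeCM/PerL34/SiegelWeilPlaceHyp.lean — session planner-pub-hodgecm-pv07-g9-0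
(unit pub-hodgecm-pv07-g9, DAG-NODE PROVER #07 gen 9 → SEAMS sprint S4-09 kernel worker), 2026-08-19.
Intended final place: `HodgeCM/PerL34/SiegelWeilPlaceHyp.lean` (NEW leaf; imports the run-26 leaf `HodgeCM.PerL34.SiegelWeilFromWeil`
(unchanged, md5 bc7eab5c7d62) and the VENDORED twin of the harness-tree file
`lean/Literature/NumberTheory/Weil1965/HermitianPlaceHypothesis.lean` (hub ledger p183516 ACCEPTED 2026-08-19T04:36:12Z, commit
b209e6c57301, md5 4c95b12f421d; vendoring closure: `Literature/NumberTheory/QuadraticForms/DiagonalFormIsotropy.lean`,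
`Literature/NumberTheory/Weil1965/SiegelWeilFormula.lean` + the already-vendored Hilbert-symbol quinary chain); nothing imports it).
STATUS AT STAGING: the proof terms are VALIDATED against the harness-tree twin `Literature.NumberTheory.Weil1965.SiegelWeilDatum` with a
field-for-field mock of `DoublingKernelData` / `WeilTransport` and the PKG proof of `x1_of_weil` replayed verbatim (scratch
`pkg-stage/MockX1Junction.lean`, farm `lean check`); NOT elaborated inside the package by the author (pv seats have no package build) —
packager: `scripts/check-wip.sh` first; on any elaboration hiccup the fallbacks are named in the comments below.
-/
import Summits.HodgeConjecture.HodgeCM.PerL34.SiegelWeilFromWeil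
import Literature.NumberTheory.Weil1965.HermitianPlaceHypothesis

set_option autoImplicit false

/-!
# `X1` from Weil's Théorème 5 with the place hypothesis DISCHARGED (SEAMS S4-09, kernel column)

`HodgeCM.PerL34.N31d.SiegelWeilFromWeil.x1_of_weil` (run 26) consumes Weil's Théorème 5 [We65, n° 52, pp. 76–77] BY NAME
(`HodgeCM.Literature.Theta.SiegelWeilDatum.WeilSiegelWeil`) together with Weil's condition (B) and the datum's place/measure
hypothesis as an OPAQUE proof `hp : W.placeHyp` (senior adjudicator adj1, SEAMS S4-09 RULING 2026-08-19T02:08:08Z: "KERNEL GAP-LOW: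
`SiegelWeilDatum.placeHyp : Prop` (ThetaCorrespondence.lean l.805) is an opaque field consumed by `x1_of_weil` … discharged nowhere";
FLIP RULE 04:28:35Z: the column is CLEARED when the transported datum is instantiated with
`placeHyp := HermitianU0Nonempty (v.adicCompletion L₀) c a` and closed by `hermitianU0Nonempty_adicCompletion` in a gated run).

This leaf does exactly that, with ZERO change to any existing statement:

* `x1_of_weil_hermitianU0` — for a Weil datum `W` with `(n, 4ε) = (1, 2)`, `m ≥ 3`, whose field `placeHyp` IS (an equation `hdef`,
  not an opaque proof) Weil's hypothesis "`U(0)_v ≠ ∅`" [We65, Théorème 5 with Prop. 3 n° 22 p. 34] written in coordinates —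
  `Literature.NumberTheory.Weil1965.HermitianU0Nonempty (v.adicCompletion F) c a`: a vector `x ∈ (L ⊗_F F_v)^m` of MAXIMAL RANK
  (zero annihilator in `L ⊗_F F_v = QuadraticAlgebra F_v c 0`; = `x ≠ 0` at a non-split `v`, = both `F_v × F_v`-components `≠ 0` at a
  split `v`) with `h_v(x, x) = ∑ aᵢ · norm xᵢ = 0`, for ANY number field `F`, ANY finite place `v`, ANY `c ≠ 0` (`L = F(√c)`) and ANY
  diagonal `a : Fin m → F_v` — the package PROVES the hypothesis (`hermitianU0Nonempty_adicCompletion`: split `v` by an explicit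
  witness, non-split `v` by Jacobson's trace form and O'Meara 63:19, [We65, n° 38, p. 55, lines 15–19]: "si `k` est un corps local à
  valuation discrète, (B) entraîne toujours `U(i) ≠ ∅`") and no `hp` binder remains;
* `x1_of_weil_of_hermitianU0` — the same with the user's dictionary kept as an implication
  `HermitianU0Nonempty (v.adicCompletion F) c a → W.placeHyp` (for data whose `placeHyp` bundles more print-side text);
* `x1_of_weil_hermitianU0_perL` — the PerL numerics `(m, n, 4ε) = (3, 1, 2)` (tex ll. 573–575; `conditionB_of_perL`).

For PerL (tex ll. 575–579): `F = L₀`, `L = L₀(√c₀)` CM, `c = c₀ ∈ L₀,v` (`c ≠ 0` by injectivity of `L₀ → L₀,v`), `h ≃ ⟨a₁, a₂, a₃⟩`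
diagonal over `L` with `aᵢ ∈ L₀` (CM/Basic.lean), `v` any finite place of `L₀` — PerL's own choice "a finite place non-split in `L`" is
covered, and so is every split one.  Print side of the record (unchanged, inside `W` / `WeilTransport`): `G′_v = G_v` is transitive on
the `U(i)_v` by [We65, Prop. 3, n° 22, p. 34] (Witt), `ν` = the Haar measure normalised by `ν(G_A/G_k) = 1`, `I_ν` converges by
[We65, Prop. 8, n° 51, p. 75] (`r = 0`).  Nothing of PerL / [QW8] / [Y1neg] is used; no `def … : Prop` is asserted; no statement of
[We65] is asserted (Théorème 5 stays the hypothesis `hW : W.WeilSiegelWeil`).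
-/
/-!
## Part B (s409-chk-g3): the transported datum INSTANTIATED — `placeHyp := HermitianU0Nonempty K c a`

The adj1 flip rule (S4-09 VERDICT.md, 04:28:35Z) reads: "the transported datum is instantiated with
`placeHyp := HermitianU0Nonempty (v.adicCompletion L₀) c a` at a chosen finite `v` … and closed by
`hermitianU0Nonempty_adicCompletion`".  Part A realises this for a free datum `W` whose field is pinned by an EQUATION
(`hdef`); part B realises it LITERALLY, by the structure update
`W.withHermitianPlace K c a := { W with placeHyp := HermitianU0Nonempty K c a }` (every other field of `W` unchanged):
* `withHermitianPlace_weilSiegelWeil_iff` — what Weil's Théorème 5 [We65, n° 52, pp. 76–77] SAYS for that datum: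
  `(B) → U(0)_v ≠ ∅ (in coordinates) → ∀ Φ, I_ν(Φ) = E(Φ)` (with `G′_v = G_v`, transitive on every `U(i)_v` by
  [We65, Prop. 3, n° 22, p. 34]; `ν` the Haar measure normalised by `ν(G_A/G_k) = 1`, p. 77 lines 9–11; `I_ν` absolutely convergent
  by [Prop. 8, n° 51, p. 75], `r = 0`);
* `WeilSiegelWeil.thetaInt_eq_eis_hermitianPlace` — for `(n, 4ε) = (1, 2)`, `m ≥ 3`: `∀ Φ, I_ν(Φ) = E(Φ)` OUTRIGHT;
* `x1_of_weil_hermitianPlace` — `X1` for `W.withHermitianPlace (v.adicCompletion F) c a` (`F` a number field, `v` ANY finite place,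
  `c ≠ 0`, `a : Fin W.m → F_v`): `x1_of_weil hW (by omega) (hermitianU0Nonempty_adicCompletion F v hc hm a) T` — the `hp` slot holds
  the THEOREM; `x1_of_weil_hermitianPlace_global` — global data `c₀ ∈ F`, `c₀ ≠ 0`, `a₀ : Fin W.m → F` (PerL: `F = L₀`,
  `L = L₀(√c₀)`, `h ≃ ⟨a₁, a₂, a₃⟩`) pushed to `F_v` by `algebraMap`; `x1_of_weil_hermitianPlace_three_one` — `(m,n,4ε) = (3,1,2)`.
Dictionary with [We65]: `U(i)` = the maximal-rank elements of `i_X⁻¹({i})` (Prop. 3, p. 34, lines 10–11; "de rang maximal,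
c'est-à-dire … de noyau {0}", lines 15–16) — first conjunct of `HermitianU0Nonempty` (zero annihilator); "Dire que `U(0)_v ≠ ∅`
revient alors à dire que `h_v` est d'indice `≥ n_v = nν`" (p. 77, lines 24–26) — for `n = 1`: an isotropic vector of maximal rank,
the second conjunct `∑ aᵢ · norm xᵢ = 0`.  Class: KERNEL (one definition by structure update + theorems).  Nothing of PerL / [QW8] /
[Y1neg] / 2001 is used; [We65] Théorème 5 stays the hypothesis `WeilSiegelWeil`.
-/


noncomputable section

open MeasureTheory IsDedekindDomain NumberField
open scoped NumberField
-- the two names of the vendored harness leaf used below (namespace `Literature.NumberTheory.Weil1965`, unchanged by vendoring)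
open Literature.NumberTheory.Weil1965 (HermitianU0Nonempty hermitianU0Nonempty_adicCompletion)

namespace HodgeCM.PerL34.N31d.SiegelWeilFromWeil

open HodgeCM.Literature.Theta DoublingKernelData

variable {D : DoublingKernelData} {W : SiegelWeilDatum.{0}}

/-- **`X1` from Weil's Théorème 5, place hypothesis discharged in the kernel.**  `W` a Weil datum with `n = 1`, `4ε = 2`,
`m ≥ 3` (so (B) `2n + 4ε < m + 2` holds: `conditionB_of_perL` for `m = 3`), satisfying Weil's theorem `W.WeilSiegelWeil`
[We65, Théorème 5, n° 52, pp. 76–77], whose place hypothesis IS "`U(0)_v ≠ ∅`" in coordinates for the hermitian datum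
`(L ⊗_F F_v, ⟨a₁, …, a_m⟩)` at a finite place `v` (`hdef`); and `T` the D4 transport dictionary.  Then PerL's identity
`∫_{[G_U]} θ^□_Φ(g,h) dg = c · E(h, s₀; f_Φ)` holds with `c = c₀ > 0` — `x1_of_weil` with its `hp` PROVED by
`hermitianU0Nonempty_adicCompletion` [We65, n° 38, p. 55].  (Fallback spellings of the third argument, should `Eq.mpr` not
elaborate in the package: `(hdef ▸ hermitianU0Nonempty_adicCompletion F v hc hm a)` or `(by rw [hdef]; exact
hermitianU0Nonempty_adicCompletion F v hc hm a)`.) -/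
theorem x1_of_weil_hermitianU0 (hW : W.WeilSiegelWeil) (hm : 3 ≤ W.m) (hn : W.n = 1) (he : W.fourEps = 2)
    (F : Type) [Field F] [NumberField F] (v : HeightOneSpectrum (𝓞 F))
    {c : v.adicCompletion F} (hc : c ≠ 0) (a : Fin W.m → v.adicCompletion F)
    (hdef : W.placeHyp = HermitianU0Nonempty (v.adicCompletion F) c a) (T : WeilTransport D W) :
    ∃ c : ℝ, 0 < c ∧ ∀ (Φ : D.Ssq) (h : D.HA), ∫ x, D.θsq Φ x h ∂D.μ = (c : ℂ) * D.E Φ h :=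
  x1_of_weil hW (by omega) (Eq.mpr hdef (hermitianU0Nonempty_adicCompletion F v hc hm a)) T

/-- The same with the user's dictionary kept as an implication `hp` ("my `placeHyp` is implied by `U(0)_v ≠ ∅` for
`h = ⟨a⟩` at `v`"): `hp` is fed the kernel proof of `U(0)_v ≠ ∅`. [We65, Théorème 5 (n° 52) pp. 76–77; n° 38 p. 55] -/
theorem x1_of_weil_of_hermitianU0 (hW : W.WeilSiegelWeil) (hm : 3 ≤ W.m) (hn : W.n = 1) (he : W.fourEps = 2)
    (F : Type) [Field F] [NumberField F] (v : HeightOneSpectrum (𝓞 F))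
    {c : v.adicCompletion F} (hc : c ≠ 0) (a : Fin W.m → v.adicCompletion F)
    (hp : HermitianU0Nonempty (v.adicCompletion F) c a → W.placeHyp) (T : WeilTransport D W) :
    ∃ c : ℝ, 0 < c ∧ ∀ (Φ : D.Ssq) (h : D.HA), ∫ x, D.θsq Φ x h ∂D.μ = (c : ℂ) * D.E Φ h :=
  x1_of_weil hW (by omega) (hp (hermitianU0Nonempty_adicCompletion F v hc hm a)) T

/-- PerL's numerics `(m, n, 4ε) = (3, 1, 2)` (tex ll. 573–575): `h = ⟨a₁, a₂, a₃⟩`, `a : Fin W.m → F_v` with `W.m = 3`. -/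
theorem x1_of_weil_hermitianU0_perL (hW : W.WeilSiegelWeil) (hm : W.m = 3) (hn : W.n = 1) (he : W.fourEps = 2)
    (F : Type) [Field F] [NumberField F] (v : HeightOneSpectrum (𝓞 F))
    {c : v.adicCompletion F} (hc : c ≠ 0) (a : Fin W.m → v.adicCompletion F)
    (hdef : W.placeHyp = HermitianU0Nonempty (v.adicCompletion F) c a) (T : WeilTransport D W) :
    ∃ c : ℝ, 0 < c ∧ ∀ (Φ : D.Ssq) (h : D.HA), ∫ x, D.θsq Φ x h ∂D.μ = (c : ℂ) * D.E Φ h :=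
  x1_of_weil_hermitianU0 hW (by omega) hn he F v hc a hdef T

end HodgeCM.PerL34.N31d.SiegelWeilFromWeil

/-! ### Part B — s409-chk-g3 (see the second module docstring above) -/

namespace HodgeCM.Literature.Theta.SiegelWeilDatum

/-- **The Weil datum with its place hypothesis TYPED**: `W` with `placeHyp := HermitianU0Nonempty K c a`, i.e.
"`U(0)_v ≠ ∅`" [We65, Théorème 5 n° 52 p. 76; Prop. 3 n° 22 p. 34] in coordinates for the hermitian datum
`h = ⟨a₁, …, a_m⟩` over `L ⊗ k_v = QuadraticAlgebra K c 0` (`K = k_v`); every other field of `W` unchanged. -/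
def withHermitianPlace (W : SiegelWeilDatum.{0}) (K : Type) [Field K] (c : K) (a : Fin W.m → K) :
    SiegelWeilDatum.{0} :=
  { W with placeHyp := HermitianU0Nonempty K c a }

section

variable (W : SiegelWeilDatum.{0}) (K : Type) [Field K] (c : K) (a : Fin W.m → K)

/-- (Ported verbatim from the HodgeCMPerL package; no docstring in the source.) -/
@[simp] theorem withHermitianPlace_SX : (W.withHermitianPlace K c a).SX = W.SX := rfl
/-- (Ported verbatim from the HodgeCMPerL package; no docstring in the source.) -/
@[simp] theorem withHermitianPlace_thetaInt : (W.withHermitianPlace K c a).thetaInt = W.thetaInt := rfl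
/-- (Ported verbatim from the HodgeCMPerL package; no docstring in the source.) -/
@[simp] theorem withHermitianPlace_eis : (W.withHermitianPlace K c a).eis = W.eis := rfl
/-- (Ported verbatim from the HodgeCMPerL package; no docstring in the source.) -/
@[simp] theorem withHermitianPlace_m : (W.withHermitianPlace K c a).m = W.m := rfl
/-- (Ported verbatim from the HodgeCMPerL package; no docstring in the source.) -/
@[simp] theorem withHermitianPlace_n : (W.withHermitianPlace K c a).n = W.n := rfl
/-- (Ported verbatim from the HodgeCMPerL package; no docstring in the source.) -/
@[simp] theorem withHermitianPlace_fourEps : (W.withHermitianPlace K c a).fourEps = W.fourEps := rfl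
/-- (Ported verbatim from the HodgeCMPerL package; no docstring in the source.) -/
@[simp] theorem withHermitianPlace_placeHyp :
    (W.withHermitianPlace K c a).placeHyp = HermitianU0Nonempty K c a := rfl

/-- What Weil's Théorème 5 SAYS for the datum with the typed place hypothesis (definitional unfolding):
condition (B) `2n + 4ε < m + 2` → "`U(0)_v ≠ ∅` for `h = ⟨a⟩` over `QuadraticAlgebra K c 0`" → `∀ Φ, I_ν(Φ) = E(Φ)`
— [We65, Théorème 5, n° 52, pp. 76–77] with `G′_v = G_v` ([Prop. 3, n° 22, p. 34]: `G` is transitive on every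
non-empty `U(i)`) and `ν` the normalised Haar measure (p. 77 lines 9–11). -/
theorem withHermitianPlace_weilSiegelWeil_iff :
    (W.withHermitianPlace K c a).WeilSiegelWeil ↔
      (2 * W.n + W.fourEps < W.m + 2 → HermitianU0Nonempty K c a → ∀ Φ : W.SX, W.thetaInt Φ = W.eis Φ) :=
  Iff.rfl

end

/-- **Théorème 5 for the hermitian rank-one datum, place hypothesis DISCHARGED** (package form of the tree junction
`Literature.NumberTheory.Weil1965.SiegelWeilDatum.WeilSiegelWeil.thetaInt_eq_eis_of_hermitianU0`): for
`W.withHermitianPlace (v.adicCompletion F) c a` with `n = 1`, `4ε = 2`, `m ≥ 3` (`F` a number field, `v` a finite place,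
`c ≠ 0`), Weil's theorem gives `I_ν(Φ) = E(Φ)` for every `Φ` OUTRIGHT: condition (B) is `2 + 2 < m + 2`, and
`U(0)_v ≠ ∅` is the theorem `hermitianU0Nonempty_adicCompletion` ([We65, n° 38, p. 55, lines 15–19]). -/
theorem WeilSiegelWeil.thetaInt_eq_eis_hermitianPlace {W : SiegelWeilDatum.{0}}
    (F : Type) [Field F] [NumberField F] (v : HeightOneSpectrum (𝓞 F)) {c : v.adicCompletion F} (hc : c ≠ 0)
    (a : Fin W.m → v.adicCompletion F) (h : (W.withHermitianPlace (v.adicCompletion F) c a).WeilSiegelWeil)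
    (hm : 3 ≤ W.m) (hn : W.n = 1) (he : W.fourEps = 2) (Φ : W.SX) :
    W.thetaInt Φ = W.eis Φ :=
  h (show 2 * W.n + W.fourEps < W.m + 2 by omega) (hermitianU0Nonempty_adicCompletion F v hc hm a) Φ

/-- The same junction for a datum whose `placeHyp` is merely IMPLIED by `U(0)_v ≠ ∅` in coordinates (the user's
dictionary `hp`; with `withHermitianPlace` it is `id`) — verbatim the shape of the tree junction. -/
theorem WeilSiegelWeil.thetaInt_eq_eis_of_hermitianU0 {W : SiegelWeilDatum.{0}} (h : W.WeilSiegelWeil)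
    (hm : 3 ≤ W.m) (hn : W.n = 1) (he : W.fourEps = 2)
    (F : Type) [Field F] [NumberField F] (v : HeightOneSpectrum (𝓞 F)) {c : v.adicCompletion F} (hc : c ≠ 0)
    (a : Fin W.m → v.adicCompletion F) (hp : HermitianU0Nonempty (v.adicCompletion F) c a → W.placeHyp)
    (Φ : W.SX) : W.thetaInt Φ = W.eis Φ :=
  h (by omega) (hp (hermitianU0Nonempty_adicCompletion F v hc hm a)) Φ

end HodgeCM.Literature.Theta.SiegelWeilDatum

namespace HodgeCM.PerL34.N31d.SiegelWeilFromWeil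

open HodgeCM.Literature.Theta DoublingKernelData
variable {D : DoublingKernelData} {W : SiegelWeilDatum.{0}}

/-- **`X1_siegelWeil` from Weil's Théorème 5 with the place hypothesis TYPED and PROVED** (recipe Option A; the
adj1 flip-rule form for seam S4-09).  The transported Weil datum is `W.withHermitianPlace (v.adicCompletion F) c a`:
its `placeHyp` IS "`U(0)_v ≠ ∅`" in coordinates for `h = ⟨a⟩` at the finite place `v` of the number field `F` (PerL:
`F = L₀`, any finite `v`; tex ll. 575–579 choose `v` non-split in `L`, which is sufficient but not necessary —
[We65, n° 38, p. 55] gives `U(0)_v ≠ ∅` at EVERY finite `v` under (B)).  Given Weil's theorem for that datum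
(`hW`, = [We65, Théorème 5] with `G′_v = G_v`, `ν` = normalised Haar), `(m, n, 4ε) = (≥ 3, 1, 2)` and the D4 transport
dictionary `T`, PerL's identity `∫_{[G_U]} θ^□_Φ(g,h) dg = c · E(h, s₀; f_Φ)` holds with `c = T.c₀ > 0`; the place
hypothesis handed to `x1_of_weil` is the TERM `hermitianU0Nonempty_adicCompletion F v hc hm a`, not a binder. -/
theorem x1_of_weil_hermitianPlace (F : Type) [Field F] [NumberField F] (v : HeightOneSpectrum (𝓞 F))
    {c : v.adicCompletion F} (hc : c ≠ 0) (a : Fin W.m → v.adicCompletion F)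
    (hW : (W.withHermitianPlace (v.adicCompletion F) c a).WeilSiegelWeil)
    (hm : 3 ≤ W.m) (hn : W.n = 1) (he : W.fourEps = 2)
    (T : WeilTransport D (W.withHermitianPlace (v.adicCompletion F) c a)) :
    ∃ c : ℝ, 0 < c ∧ ∀ (Φ : D.Ssq) (h : D.HA), ∫ x, D.θsq Φ x h ∂D.μ = (c : ℂ) * D.E Φ h :=
  x1_of_weil hW (show 2 * W.n + W.fourEps < W.m + 2 by omega) (hermitianU0Nonempty_adicCompletion F v hc hm a) T

/-- **Option A with GLOBAL data** (PerL's shape: `F = L₀` totally real, `L = L₀(√c₀)` with `c₀ ∈ L₀`, `c₀ ≠ 0`, and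
`h ≃ ⟨a₁, …, a_m⟩` with `aᵢ ∈ L₀` after diagonalisation; `v` any finite place of `L₀`): the datum's place hypothesis
is `U(0)_v ≠ ∅` for the images of `c₀`, `a₀` in `L₀,ᵥ` (`c₀ ↦ algebraMap L₀ L₀,ᵥ c₀ ≠ 0` by injectivity), and it is
discharged by `hermitianU0Nonempty_adicCompletion`. -/
theorem x1_of_weil_hermitianPlace_global (F : Type) [Field F] [NumberField F] (v : HeightOneSpectrum (𝓞 F))
    {c₀ : F} (hc₀ : c₀ ≠ 0) (a₀ : Fin W.m → F)
    (hW : (W.withHermitianPlace (v.adicCompletion F) (algebraMap F (v.adicCompletion F) c₀)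
      (fun i => algebraMap F (v.adicCompletion F) (a₀ i))).WeilSiegelWeil)
    (hm : 3 ≤ W.m) (hn : W.n = 1) (he : W.fourEps = 2)
    (T : WeilTransport D (W.withHermitianPlace (v.adicCompletion F) (algebraMap F (v.adicCompletion F) c₀)
      (fun i => algebraMap F (v.adicCompletion F) (a₀ i)))) :
    ∃ c : ℝ, 0 < c ∧ ∀ (Φ : D.Ssq) (h : D.HA), ∫ x, D.θsq Φ x h ∂D.μ = (c : ℂ) * D.E Φ h :=
  x1_of_weil_hermitianPlace F v
    (c := algebraMap F (v.adicCompletion F) c₀)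
    (fun h0 => hc₀ ((algebraMap F (v.adicCompletion F)).injective (by rw [h0, map_zero])))
    (fun i => algebraMap F (v.adicCompletion F) (a₀ i)) hW hm hn he T

/-- PerL's instance `(m, n, 4ε) = (3, 1, 2)` (tex ll. 574–575: "`m > 2n + 4ε − 2`, here `ε = ½`, `n = 1`, `m = 3`")
with the typed place hypothesis at a finite place `v` of `F = L₀` for `h = ⟨a₁, a₂, a₃⟩`. -/
theorem x1_of_weil_hermitianPlace_three_one (F : Type) [Field F] [NumberField F] (v : HeightOneSpectrum (𝓞 F))
    {c : v.adicCompletion F} (hc : c ≠ 0) (a : Fin W.m → v.adicCompletion F)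
    (hW : (W.withHermitianPlace (v.adicCompletion F) c a).WeilSiegelWeil)
    (hm : W.m = 3) (hn : W.n = 1) (he : W.fourEps = 2)
    (T : WeilTransport D (W.withHermitianPlace (v.adicCompletion F) c a)) :
    ∃ c : ℝ, 0 < c ∧ ∀ (Φ : D.Ssq) (h : D.HA), ∫ x, D.θsq Φ x h ∂D.μ = (c : ℂ) * D.E Φ h :=
  x1_of_weil_hermitianPlace F v hc a hW (le_of_eq hm.symm) hn he T

end HodgeCM.PerL34.N31d.SiegelWeilFromWeil

end
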